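import Mathlib
import HarnessLib
import Summits.NavierStokesRegularity.NavierStokesRegularity.Theorems.UnthreadedDoorAntidynamoWallOneInstantZonal
import Summits.NavierStokesRegularity.NavierStokesRegularity.Theorems.UnthreadedDoorCellFluxZonalKinematic
import Summits.NavierStokesRegularity.NavierStokesRegularity.Theorems.ThreadingFluxSilentShellsAxisPinning

/-!
# Route `UnthreadedDoor` / `ThreadingFlux`, crux `PoloidalLiouville` (stmt-NavierStokesRegularity-1222), antidynamo v2 skeleton (sha16 `4ebf5683127b`),
# WALL `stub_scalarLiouville`: ★★★ AXISYMMETRIC VORTICITY — WITH SWIRL, ABOUT ANY AXIS — AT ONE INSTANT ⇒ IRROTATIONAL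

Support file (seat leafhand-ns-unthreadeddoor-2 g2, cell decomp-ns), `--supports stmt-NavierStokesRegularity-1222 --as helper`; theorems only.

* ★★★ `curl_eq_zero_of_axisymNoSwirlAbout_slice` — the ONE-SLICE ENTRANCE to the Z pipeline: if ONE slice `v(t₁) − k` of a flow of the wall's class
  (bounded ancient mild, measurable slices, jointly smooth, vorticity tangent to the spheres about `x₀`) is axisymmetric WITHOUT swirl about ANY axis
  (through any point `x₁`, straightened by any frame `R`), then `curl v ≡ 0` on `(−∞,0) × ℝ³`.  [Same proof as the one-instant Z
  `curl_eq_zero_of_flat_direction_slice`, entered one step later: Oseen gauge, constant Galilean boost, one-slice symmetry propagation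
  (`OneInstant.isAxisymmetricNoSwirlAbout_boost_of_slice`), moving-axis dichotomy, axis freezing Z-1b, KNSS transfer Z-3.]
* ★★★ `curl_eq_zero_of_curl_axisymmetric_slice` — **AXISYMMETRIC VORTICITY AT ONE INSTANT ⇒ IRROTATIONAL, SWIRL ALLOWED**: if at ONE `t₁ < 0` the
  vorticity, seen in some frame `conjAxis R x₁`, is an axisymmetric vector field (i.e. `curl v(t₁)` is symmetric as a pseudovector under ALL rotations
  about the axis through `x₁` with direction `R⁻¹e_z` — no assumption on the swirl, no assumption `x₁ = x₀`), then `curl v ≡ 0`.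
  [Coboundary lemma `CellFlux.isAxisymmetric_sub_apply_zero` (KNSS Lemma 3.1): the straightened slice minus its value on the axis is an axisymmetric
  VELOCITY; tangency to the spheres about `x₀` pins `x₀` to the axis or kills the vorticity (`SilentShells.axisPinning_dichotomy`); on the axis, tangency
  forces NO SWIRL (`SilentShells.hasNoSwirl_of_isAxisymmetric_of_unthreaded_axisPoint`: the swirl `Γ = r u_θ` is constant on the meridional circles
  about `x₀` and vanishes on the axis); then the first theorem.]  So the «exactly axisymmetric core» of the g0/g1 residual list is EMPTY, and it is
  killed from ONE instant.
* the wall's letters and `constant_of_…` forms.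

HONEST LABEL: assembly over landed theorems; nothing here proves `stub_scalarLiouville`, `PoloidalLiouville` (1222), or bears on Navier–Stokes regularity;
no summit statement is proved (crux 1222 is INCOMPARABLE with the summit). [folklore] [cite: KochNadirashviliSereginSverak2009, Lemma 3.1, Thm 5.2, §4
(arXiv:0709.3599 pp. 6–10); LemarieRieusset2016, Thm. 9.12; MajdaBertozziCUP2002, §1.2, §2.3.3]
-/

noncomputable section

-- the summit and its single sub-problem share the name (CONVENTIONS §1)
set_option linter.dupNamespace false

open scoped Topology InnerProductSpace RealInnerProductSpace ContDiff
open Filter Set Function Metric MeasureTheory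
open Literature.Analysis Literature.Analysis.FluidPDE

namespace Summit.NavierStokesRegularity.NavierStokesRegularity.Theorems.PoloidalLiouville.Antidynamo

open Summit.NavierStokesRegularity.NavierStokesRegularity.Theorems.PoloidalLiouville
  (toroidalPotential exists_norm_curl_le constantOfIrrotational)
open Summit.NavierStokesRegularity.NavierStokesRegularity.Theorems.PoloidalLiouville.NetFlux (E3)
open Summit.NavierStokesRegularity.NavierStokesRegularity.Theorems.PoloidalLiouville.CellFlux
  (conjAxis IsAxisymmetricNoSwirlAbout conjAxis_apply)

namespace OneInstant

/-! ### ★★★ The one-slice entrance to the Z pipeline -/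

/-- ★★★ **ONE SWIRL-FREE AXISYMMETRIC SLICE (UP TO A CONSTANT, ABOUT ANY AXIS) ⇒ IRROTATIONAL AT ALL TIMES.**  Let `v` be a bounded ancient mild solution
(`ν = 1`, duality class) with measurable slices, jointly smooth on `(−∞,0) × ℝ³`, whose vorticity is tangent to the spheres about `x₀` at all times.  If
for ONE `t₁ < 0`, ONE frame `R`, ONE point `x₁` and ONE constant `k` the slice `v(t₁) − k` is axisymmetric without swirl about the axis through `x₁`
straightened by `R`, then `curl v ≡ 0` on `(−∞,0) × ℝ³`.
[cite: KochNadirashviliSereginSverak2009, Thm 5.2 and §4 (arXiv:0709.3599 pp. 8–10); LemarieRieusset2016, Thm. 9.12; MajdaBertozziCUP2002, §1.2, §2.3.3] -/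
theorem curl_eq_zero_of_axisymNoSwirlAbout_slice
    (v : ℝ → EuclideanSpace ℝ (Fin 3) → EuclideanSpace ℝ (Fin 3)) (x₀ : EuclideanSpace ℝ (Fin 3))
    (hB : Literature.Analysis.FluidPDE.IsBoundedAncientMildSolution 1 v)
    (hm : ∀ t < 0, AEStronglyMeasurable (v t) volume)
    (hsm : ContDiffOn ℝ (⊤ : ℕ∞) (Function.uncurry v) (Set.Iio 0 ×ˢ Set.univ))
    (hun : ∀ t < 0, ∀ x, ⟪x - x₀, curl (v t) x⟫ = 0)
    (h₁ : ∃ t₁ < 0, ∃ (R : EuclideanSpace ℝ (Fin 3) ≃ₗᵢ[ℝ] EuclideanSpace ℝ (Fin 3)) (x₁ k : EuclideanSpace ℝ (Fin 3)),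
      IsAxisymmetricNoSwirlAbout R x₁ (fun y => v t₁ y - k)) :
    ∀ t < 0, ∀ x, curl (v t) x = 0 := by
  obtain ⟨t₁, ht₁, R, x₁, k, hk⟩ := h₁
  have hsm' : IsSmoothSpaceTimeOn (Iio 0) v := hsm
  -- ## the Oseen gauge, everywhere
  obtain ⟨w, A, c, -, hwc, ⟨K, hK⟩, hwdiv, hwmild, -, hrep⟩ := Theorems.oseen_gauge_of_aestronglyMeasurable v hB hm
  have hrep' : ∀ s < 0, ∀ y, v s y = w s (y - A s) + c s :=
    fun s hs y => CellFlux.galilean_rep_everywhere hsm.continuousOn hwc hrep hs y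
  -- ## the slice at `t₁`, re-centred at `p₀ = x₁ − A t₁`
  set p₀ : E3 := x₁ - A t₁ with hp₀
  set k₀ : E3 := k - c t₁ with hk₀
  have hR : IsAxisymmetricNoSwirlAbout R p₀ (fun y => w t₁ y - k₀) := by
    have e : conjAxis R p₀ (fun y => w t₁ y - k₀) = conjAxis R x₁ (fun y => v t₁ y - k) := by
      funext y
      simp only [conjAxis_apply, hk₀]
      rw [hrep' t₁ ht₁]
      have e1 : R.symm y + p₀ = R.symm y + x₁ - A t₁ := by rw [hp₀]; abel
      rw [e1]
      congr 1
      abel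
    unfold IsAxisymmetricNoSwirlAbout
    rw [e]
    exact hk
  -- ## the boosted representative is swirl-free axisymmetric about `(p₀, R)` at every time
  have hsym := isAxisymmetricNoSwirlAbout_boost_of_slice hwc ⟨K, hK⟩ hwdiv hwmild ht₁ hR
  -- ## back to `v`: at every `t`, `v t − κ t` is swirl-free axisymmetric about the parallel axis through `q t`
  set ez : E3 := EuclideanSpace.single 2 (1 : ℝ) with hez
  set q : ℝ → E3 := fun t => p₀ + (A t + (t - t₁) • k₀) with hq
  set κ : ℝ → E3 := fun t => k₀ + c t with hκ
  have hvq : ∀ t < 0, IsAxisymmetricNoSwirlAbout R (q t) (fun x => v t x - κ t) := by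
    intro t ht
    have e1 : (fun x => v t x - κ t) =
        fun x => (fun t y => w t (y + (t - t₁) • k₀) - k₀) t (x - (A t + (t - t₁) • k₀)) := by
      funext x
      simp only [hκ]
      rw [hrep' t ht x]
      have e2 : x - (A t + (t - t₁) • k₀) + (t - t₁) • k₀ = x - A t := by abel
      rw [e2]
      abel
    rw [e1]
    exact (isAxisymmetricNoSwirlAbout_translate_iff R p₀ (A t + (t - t₁) • k₀) _).2 (hsym t ht)
  -- ## `curl v(t) ⊥ q t − x₀` at every time
  have hd : ∀ t < 0, ∀ x, ⟪q t - x₀, curl (v t) x⟫ = 0 := by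
    intro t ht x
    have hv1 : ContDiff ℝ 1 (v t) := (hsm'.contDiff_slice ht).of_le (by norm_cast)
    have hWc : ContDiff ℝ 1 (conjAxis R (q t) fun z => v t z - κ t) := CellFlux.contDiff_conjAxis hv1 R (q t) (κ t)
    have h2 := CellFlux.inner_curl_eq_zero_of_noSwirl (hvq t ht).1 (hvq t ht).2 hWc (R (x - q t))
    rw [CellFlux.curl_conjAxis_sub_const, LinearIsometryEquiv.symm_apply_apply, sub_add_cancel, inner_smul_right,
      LinearIsometryEquiv.inner_map_map] at h2
    have h3 : ⟪x - q t, curl (v t) x⟫ = 0 := (mul_eq_zero.1 h2).resolve_left (CellFlux.det_ne_zero R)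
    have e3 : q t - x₀ = (x - x₀) - (x - q t) := by abel
    rw [e3, inner_sub_left, hun t ht x, h3, sub_zero]
  -- ## case A: an irrotational slice
  by_cases hA : ∃ t < 0, ∀ x, curl (v t) x = 0
  · exact curl_eq_zero_of_curl_slice_eq_zero v x₀ hB hm hsm hun hA
  -- ## case B: `x₀` lies on the axis at every time ⇒ one swirl-free frame about `x₀` ⇒ Z-1b + Z-3
  have hA' : ∀ t < 0, ∃ x, curl (v t) x ≠ 0 := by
    intro t ht
    by_contra h
    push Not at h
    exact hA ⟨t, ht, h⟩
  have hP : ∀ t < 0, ∃ (R' : E3 ≃ₗᵢ[ℝ] E3) (c' : E3), IsAxisymmetricNoSwirlAbout R' x₀ (fun y => v t y - c') := by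
    intro t ht
    obtain ⟨x₂, hx₂⟩ := hA' t ht
    have hv1 : ContDiff ℝ 1 (v t) := (hsm'.contDiff_slice ht).of_le (by norm_cast)
    obtain ⟨μ, hμ⟩ := CellFlux.exists_smul_dir_of_forall_inner_curl hv1 (hvq t ht).1 (hvq t ht).2 hx₂ (hd t ht)
    refine ⟨R, κ t, isAxisymmetricNoSwirlAbout_of_add_smul_dir (μ := μ) ?_⟩
    have e4 : x₀ + μ • R.symm ez = q t := by rw [← hμ]; abel
    rw [e4]
    exact hvq t ht
  obtain ⟨K', hK'⟩ := exists_norm_curl_le hB hsm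
  obtain ⟨T, -, -, hlink⟩ := toroidalPotential v x₀ K' hsm hK' hun
  exfalso
  obtain ⟨x, hx⟩ := hA' t₁ ht₁
  obtain ⟨R', hR'⟩ := CellFlux.axisFrozen v x₀ T hB hm hsm hlink hP t₁ ht₁ fun t ht => hA' t (lt_of_le_of_lt ht ht₁)
  exact hx (CellFlux.knssTransfer v x₀ hB hm hsm t₁ ht₁ R' hR' t₁ le_rfl x)

/-! ### ★★★ Axisymmetric vorticity — with swirl — at one instant -/

/-- ★★★ **AXISYMMETRIC VORTICITY AT ONE INSTANT ⇒ IRROTATIONAL (SWIRL ALLOWED, ANY AXIS).**  Let `v` be as above (vorticity tangent to the spheres about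
`x₀` at all times).  If at ONE `t₁ < 0`, in SOME frame `conjAxis R x₁` (axis through `x₁` with direction `R⁻¹e_z`), the vorticity of the straightened slice
is an AXISYMMETRIC VECTOR FIELD, then `curl v ≡ 0` on `(−∞,0) × ℝ³`: by the coboundary lemma the straightened slice minus its value on the axis is an
axisymmetric velocity; tangency about `x₀` pins `x₀` to the axis (else the slice is irrotational, `SilentShells.axisPinning_dichotomy`), where it forces
NO SWIRL (`SilentShells.hasNoSwirl_of_isAxisymmetric_of_unthreaded_axisPoint`); then `curl_eq_zero_of_axisymNoSwirlAbout_slice`.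
[cite: KochNadirashviliSereginSverak2009, Lemma 3.1, Thm 5.2 (arXiv:0709.3599 pp. 7–10); MajdaBertozziCUP2002, §2.3.3] -/
theorem curl_eq_zero_of_curl_axisymmetric_slice
    (v : ℝ → EuclideanSpace ℝ (Fin 3) → EuclideanSpace ℝ (Fin 3)) (x₀ : EuclideanSpace ℝ (Fin 3))
    (hB : Literature.Analysis.FluidPDE.IsBoundedAncientMildSolution 1 v)
    (hm : ∀ t < 0, AEStronglyMeasurable (v t) volume)
    (hsm : ContDiffOn ℝ (⊤ : ℕ∞) (Function.uncurry v) (Set.Iio 0 ×ˢ Set.univ))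
    (hun : ∀ t < 0, ∀ x, ⟪x - x₀, curl (v t) x⟫ = 0)
    (h₁ : ∃ t₁ < 0, ∃ (R : EuclideanSpace ℝ (Fin 3) ≃ₗᵢ[ℝ] EuclideanSpace ℝ (Fin 3)) (x₁ : EuclideanSpace ℝ (Fin 3)),
      IsAxisymmetric (curl (conjAxis R x₁ (v t₁)))) :
    ∀ t < 0, ∀ x, curl (v t) x = 0 := by
  obtain ⟨t₁, ht₁, R, x₁, hax⟩ := h₁
  have hsm' : IsSmoothSpaceTimeOn (Iio 0) v := hsm
  have hvt : ContDiff ℝ (⊤ : ℕ∞) (v t₁) := hsm'.contDiff_slice ht₁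
  have hv2 : ContDiff ℝ 2 (v t₁) := hvt.of_le (by norm_cast)
  have hv1 : ContDiff ℝ 1 (v t₁) := hvt.of_le (by norm_cast)
  have hdiv : VectorCalculus.IsDivFree (v t₁) := (hB.isAncientMildSolution.1 t₁ ht₁).isDivFree_of_contDiff hv1
  obtain ⟨M, hM⟩ := hB.isBoundedOn
  -- the straightened slice
  set V : E3 → E3 := conjAxis R x₁ (v t₁) with hV
  have hV2 : ContDiff ℝ 2 V := R.contDiff.comp (hv2.comp ((R.symm.contDiff).add contDiff_const))
  have hV1 : ContDiff ℝ 1 V := hV2.of_le (by norm_num)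
  have hVM : ∀ y, ‖V y‖ ≤ M := fun y => by
    rw [hV, conjAxis_apply, LinearIsometryEquiv.norm_map]
    exact hM t₁ ht₁ _
  have hVdiv : VectorCalculus.IsDivFree V := (hdiv.comp_add_right x₁).conj_linearIsometryEquiv R
  -- minus its value on the axis it is an axisymmetric VELOCITY
  have hVax : IsAxisymmetric (fun y => V y - V 0) := CellFlux.isAxisymmetric_sub_apply_zero hV2 hVM hVdiv hax
  have hV1' : ContDiff ℝ 1 (fun y => V y - V 0) := hV1.sub contDiff_const
  have hcurl' : ∀ y, curl (fun y => V y - V 0) y = curl V y := fun y => by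
    rw [curl_eq_curlCLM, curl_eq_curlCLM, fderiv_sub_const]
  -- its vorticity is tangent to the spheres about `R (x₀ − x₁)`, i.e. `⟪y + R (x₁ − x₀), curl V y⟫ = 0`
  have hVun : ∀ y, ⟪y + R (x₁ - x₀), curl (fun y => V y - V 0) y⟫ = 0 := fun y => by
    rw [hcurl', hV, CellFlux.curl_conjAxis, inner_smul_right]
    have e1 : y + R (x₁ - x₀) = R (R.symm y + x₁ - x₀) := by
      rw [add_sub_assoc, map_add, LinearIsometryEquiv.apply_symm_apply]
    rw [e1, LinearIsometryEquiv.inner_map_map]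
    have h := hun t₁ ht₁ (R.symm y + x₁)
    rw [h, mul_zero]
  -- axis pinning: `x₀` on the axis, or the slice is irrotational
  rcases SilentShells.axisPinning_dichotomy hVax hV1' (R (x₁ - x₀)) hVun with hon | hzero
  · -- on the axis: no swirl, and the one-slice entrance
    have hsw : HasNoSwirl (fun y => V y - V 0) :=
      SilentShells.hasNoSwirl_of_isAxisymmetric_of_unthreaded_axisPoint hVax hV1' hon hVun
    have hkey : conjAxis R x₁ (fun y => v t₁ y - v t₁ x₁) = fun y => V y - V 0 := by
      funext y
      simp [hV, conjAxis, map_sub]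
    refine curl_eq_zero_of_axisymNoSwirlAbout_slice v x₀ hB hm hsm hun ⟨t₁, ht₁, R, x₁, v t₁ x₁, ?_⟩
    show IsAxisymmetric (conjAxis R x₁ fun y => v t₁ y - v t₁ x₁) ∧ HasNoSwirl (conjAxis R x₁ fun y => v t₁ y - v t₁ x₁)
    rw [hkey]
    exact ⟨hVax, hsw⟩
  · -- irrotational slice
    refine curl_eq_zero_of_curl_slice_eq_zero v x₀ hB hm hsm hun ⟨t₁, ht₁, fun x => ?_⟩
    have h := hzero (R (x - x₁))
    rw [hcurl', hV, CellFlux.curl_conjAxis, LinearIsometryEquiv.symm_apply_apply, sub_add_cancel] at h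
    rcases smul_eq_zero.1 h with h1 | h1
    · exact absurd h1 (CellFlux.det_ne_zero R)
    · simpa using congrArg R.symm h1

/-- ★★★ **… HENCE SLICE-WISE CONSTANT AT ALL TIMES.** [cite: KochNadirashviliSereginSverak2009, Thm 5.2 (arXiv:0709.3599 pp. 9–10)] -/
theorem constant_of_curl_axisymmetric_slice
    (v : ℝ → EuclideanSpace ℝ (Fin 3) → EuclideanSpace ℝ (Fin 3)) (x₀ : EuclideanSpace ℝ (Fin 3))
    (hB : Literature.Analysis.FluidPDE.IsBoundedAncientMildSolution 1 v)
    (hm : ∀ t < 0, AEStronglyMeasurable (v t) volume)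
    (hsm : ContDiffOn ℝ (⊤ : ℕ∞) (Function.uncurry v) (Set.Iio 0 ×ˢ Set.univ))
    (hun : ∀ t < 0, ∀ x, ⟪x - x₀, curl (v t) x⟫ = 0)
    (h₁ : ∃ t₁ < 0, ∃ (R : EuclideanSpace ℝ (Fin 3) ≃ₗᵢ[ℝ] EuclideanSpace ℝ (Fin 3)) (x₁ : EuclideanSpace ℝ (Fin 3)),
      IsAxisymmetric (curl (conjAxis R x₁ (v t₁)))) :
    ∀ t < 0, ∃ b : EuclideanSpace ℝ (Fin 3), ∀ x, v t x = b :=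
  constantOfIrrotational v hB hsm (curl_eq_zero_of_curl_axisymmetric_slice v x₀ hB hm hsm hun h₁)

/-! ### The wall's letter -/

/-- ★★★ **THE WALL'S LETTER: AXISYMMETRIC VORTICITY (WITH SWIRL, ANY AXIS) AT ONE INSTANT ⇒ TRIVIAL.**  If the vorticity of the wall's flow is
`∇T(t,·) × (· − x₀)` and at ONE `t₁ < 0`, in some frame `conjAxis R x₁`, the straightened vorticity `curl (conjAxis R x₁ (v t₁))` is an axisymmetric
vector field, then `∇T × (x − x₀) ≡ 0` on `(−∞,0) × ℝ³`. [cite: KochNadirashviliSereginSverak2009, Thm 5.2 (arXiv:0709.3599 pp. 9–10)] -/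
theorem stubScalarLiouville_of_curl_axisymmetric_slice
    (v : ℝ → EuclideanSpace ℝ (Fin 3) → EuclideanSpace ℝ (Fin 3)) (x₀ : EuclideanSpace ℝ (Fin 3))
    (T : ℝ → EuclideanSpace ℝ (Fin 3) → ℝ)
    (hB : Literature.Analysis.FluidPDE.IsBoundedAncientMildSolution 1 v)
    (hm : ∀ t < 0, AEStronglyMeasurable (v t) volume)
    (hsm : ContDiffOn ℝ (⊤ : ℕ∞) (Function.uncurry v) (Set.Iio 0 ×ˢ Set.univ))
    (hrep : ∀ t < 0, ∀ x, Literature.Analysis.FluidPDE.curl (v t) x =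
      Literature.Analysis.FluidPDE.cross (gradient (T t) x) (x - x₀))
    (h₁ : ∃ t₁ < 0, ∃ (R : EuclideanSpace ℝ (Fin 3) ≃ₗᵢ[ℝ] EuclideanSpace ℝ (Fin 3)) (x₁ : EuclideanSpace ℝ (Fin 3)),
      IsAxisymmetric (curl (conjAxis R x₁ (v t₁)))) :
    ∀ t < 0, ∀ x, Literature.Analysis.FluidPDE.cross (gradient (T t) x) (x - x₀) = 0 := by
  have hun : ∀ t < 0, ∀ x, ⟪x - x₀, curl (v t) x⟫ = 0 := fun t ht x => by
    rw [hrep t ht x]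
    simp [cross, crossProduct, PiLp.inner_apply, Fin.sum_univ_three]
    ring
  intro t ht x
  rw [← hrep t ht x]
  exact curl_eq_zero_of_curl_axisymmetric_slice v x₀ hB hm hsm hun h₁ t ht x

end OneInstant

end Summit.NavierStokesRegularity.NavierStokesRegularity.Theorems.PoloidalLiouville.Antidynamo

end
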